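import Summits.QuantumFields.YangMills.Theses.LangevinControlUV
import Summits.QuantumFields.YangMills.Theorems.OSLegsFromFemtoAndGap.Negative.UnitsAndGapFree

/-!
# `OSLegsAtWeakCouplingC` — negative-side support II: anatomy of the new conjunct
# `sch.HasWeakCouplingLimit` (free in every proof that uses H3; load-bearing only against `β → −∞`)

Support file for crux `stmt-QuantumFields-16207`
(`Summit.QuantumFields.YangMills.Theses.LangevinControlUV.OSLegsAtWeakCouplingC`), extracted from the
standing disprover's work file `Cruxes/OSLegsAtWeakCouplingC/Disproof.lean` §3–§4. The C-crux differs
from `OSLegsFromFemtoAndGap` (stmt-9367) by the hypothesis `Continuous a` and by the conjunct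
`sch.HasWeakCouplingLimit` (`β_k → +∞`) in the conclusion. Tree objects only; H3 quoted verbatim.

* `conclC_sans_nontriviality`: from `a > 0`, `a → 0` and H3 ALONE one gets a scheme in units `a` with
  `β_k = β₂ + k → +∞`, vacuum OS data, `IsYangMillsFor` (zero renormalisations) and
  `HasLatticeMassGap r sch c₁` — the conclusion of the C-crux minus `IsNontrivial ∧ IsNonGaussian`.
  So the units clause, the NEW weak-coupling clause and the gap clause are free; all content is the
  non-vacuum continuum limit (E1, E0′, femto → large-torus decoupling), exactly as for 9367.
* `tendsto_abs_beta_of_units`: for a CONTINUOUS positive unit map, EVERY scheme in units `a` has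
  `|β_k| → ∞` (a positive continuous function is bounded below on compact windows, `a_k → 0`).
* `hasWeakCouplingLimit_of_units_of_eventually_le`: hence `HasWeakCouplingLimit` costs exactly an
  eventual lower bound on `β_k` (supplied by any use of H3, `β_k ≥ β₂`).
* `exists_unitsScheme_not_weakCoupling`: but the conjunct is NOT implied by the units clause alone,
  even for a continuous positive `a → 0`: `a β = (1 + β²)⁻¹`, `β_k = −(k+1)`. [folklore]
-/

noncomputable section

open MeasureTheory Filter Topology
open Literature.MathematicalPhysics.AQFT Literature.MathematicalPhysics.QuantumLattice
open Literature.MathematicalPhysics.QuantumFieldTheory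

namespace Summit.QuantumFields.YangMills.Theorems.OSLegsAtWeakCouplingC.Negative

section Free

variable {G : Type} [Group G] [TopologicalSpace G] [IsTopologicalGroup G] [CompactSpace G]
  [MeasurableSpace G] [BorelSpace G]

/-- **Tightness (C): the conclusion of `OSLegsAtWeakCouplingC` minus `IsNontrivial ∧ IsNonGaussian`
— INCLUDING `sch.HasWeakCouplingLimit` — follows from `a > 0`, `a → 0` and H3 alone** (H3 verbatim;
vacuum OS data, zero renormalisations, the scheme `β_k = β₂ + k`, `L_k = max (S₁ β_k) ⌈k / a(β_k)⌉₊`). [folklore] -/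
theorem conclC_sans_nontriviality (r : LatticeRep G) {a : ℝ → ℝ} (ha : ∀ β, 0 < a β)
    (hlim : Tendsto a atTop (𝓝 0))
    (h3 : ∃ (c₁ β₂ : ℝ) (S₁ : ℝ → ℕ), 0 < c₁ ∧ ∀ A B : YMSpecies G, ∃ C : ℝ, ∀ β : ℝ, β₂ ≤ β → ∀ S n : ℕ, S₁ β ≤ S → n ≤ S → |latticeConnectedCorr r.ρ β (2 * S + 1) A.F B.F n| ≤ C * Real.exp (-(c₁ * a β * n))) :
    ∃ (sch : SpeciesScheme (YMSpecies G)) (T : OSData (YMSpecies G) 4),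
      (∀ k, sch.a k = a (sch.β k)) ∧ sch.HasWeakCouplingLimit ∧ IsYangMillsFor r sch T ∧
        ∃ Δ > 0, HasLatticeMassGap r sch Δ := by
  obtain ⟨c₁, β₂, S₁, hc₁, hgap⟩ := h3
  -- the scheme in units `a`: β_k = β₂ + k, L_k = max (S₁ β_k) ⌈k / a(β_k)⌉₊, zero renormalisations
  let sch : SpeciesScheme (YMSpecies G) :=
    { a := fun k => a (β₂ + k)
      a_pos := fun k => ha _
      tendsto_a := hlim.comp (tendsto_atTop_add_const_left _ _ tendsto_natCast_atTop_atTop)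
      β := fun k => β₂ + k
      L := fun k => max (S₁ (β₂ + k)) ⌈(k : ℝ) / a (β₂ + k)⌉₊
      tendsto_L := by
        refine tendsto_atTop_mono (fun k => ?_) tendsto_natCast_atTop_atTop
        have hak := ha (β₂ + k)
        calc (k : ℝ) = a (β₂ + k) * ((k : ℝ) / a (β₂ + k)) := by field_simp
          _ ≤ a (β₂ + k) * (⌈(k : ℝ) / a (β₂ + k)⌉₊ : ℝ) :=
              mul_le_mul_of_nonneg_left (Nat.le_ceil _) hak.le
          _ ≤ a (β₂ + k) * ((max (S₁ (β₂ + k)) ⌈(k : ℝ) / a (β₂ + k)⌉₊ : ℕ) : ℝ) :=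
              mul_le_mul_of_nonneg_left (by exact_mod_cast le_max_right _ _) hak.le
      c := fun _ _ => 0
      m := fun _ _ => 0 }
  refine ⟨sch, OSData.vacuum _ 4, fun k => rfl,
    tendsto_atTop_add_const_left _ _ tendsto_natCast_atTop_atTop,
    OSLegsFromFemtoAndGap.Negative.isYangMillsFor_vacuum_of_c_zero r sch (fun _ _ => rfl), c₁, hc₁, ?_⟩
  refine OSLegsFromFemtoAndGap.Negative.hasLatticeMassGap_of_gapInUnits r hgap sch (fun k => rfl)
    (Eventually.of_forall fun k => ?_) (Eventually.of_forall fun k => le_max_left _ _)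
  show β₂ ≤ β₂ + k
  exact le_add_of_nonneg_right (Nat.cast_nonneg k)

end Free

section Conjunct

variable {ι : Type}

/-- **Any scheme in CONTINUOUS positive units leaves every compact coupling window: `|β_k| → ∞`.** [folklore] -/
theorem tendsto_abs_beta_of_units {a : ℝ → ℝ} (ha : Continuous a) (hpos : ∀ β, 0 < a β)
    (sch : SpeciesScheme ι) (hu : ∀ k, sch.a k = a (sch.β k)) :
    Tendsto (fun k => |sch.β k|) atTop atTop := by
  rw [tendsto_atTop]
  intro M
  rcases lt_or_ge M 0 with hM | hM
  · exact Eventually.of_forall fun k => (hM.le.trans (abs_nonneg _))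
  obtain ⟨x₀, hx₀, hmin⟩ := (isCompact_Icc : IsCompact (Set.Icc (-M) M)).exists_isMinOn
    ⟨0, by constructor <;> linarith⟩ ha.continuousOn
  have hε : 0 < a x₀ := hpos x₀
  have hev : ∀ᶠ k in atTop, sch.a k < a x₀ := sch.tendsto_a.eventually (gt_mem_nhds hε)
  filter_upwards [hev] with k hk
  by_contra hlt
  push Not at hlt
  have hmem : sch.β k ∈ Set.Icc (-M) M := by
    constructor <;> [linarith [neg_abs_le (sch.β k)]; linarith [le_abs_self (sch.β k)]]
  have := hmin hmem
  rw [Set.mem_setOf_eq, ← hu k] at this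
  linarith

/-- **… so `HasWeakCouplingLimit` costs exactly an eventual lower bound on `β_k`.** [folklore] -/
theorem hasWeakCouplingLimit_of_units_of_eventually_le {a : ℝ → ℝ} (ha : Continuous a)
    (hpos : ∀ β, 0 < a β) (sch : SpeciesScheme ι) (hu : ∀ k, sch.a k = a (sch.β k)) {B : ℝ}
    (hB : ∀ᶠ k in atTop, B ≤ sch.β k) : sch.HasWeakCouplingLimit := by
  unfold SpeciesScheme.HasWeakCouplingLimit
  rw [tendsto_atTop]
  intro M
  have h := (tendsto_atTop.1 (tendsto_abs_beta_of_units ha hpos sch hu)) (max M (|B| + 1))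
  filter_upwards [h, hB] with k hk hkB
  have h1 : |B| + 1 ≤ |sch.β k| := le_of_max_le_right hk
  have h2 : M ≤ |sch.β k| := le_of_max_le_left hk
  have hnonneg : 0 ≤ sch.β k := by
    by_contra hneg
    push Not at hneg
    rw [abs_of_neg hneg] at h1
    linarith [neg_abs_le B]
  rwa [abs_of_nonneg hnonneg] at h2

variable (ι) in
/-- **The weak-coupling conjunct is NOT implied by the units clause**, even for a continuous,
positive unit map tending to `0` at `+∞`: `a β = (1 + β²)⁻¹`, scheme `β_k = −(k+1)`,
`a_k = (1 + (k+1)²)⁻¹`, `L_k = (k+1)³`. [folklore] -/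
theorem exists_unitsScheme_not_weakCoupling :
    ∃ a : ℝ → ℝ, Continuous a ∧ (∀ β, 0 < a β) ∧ Tendsto a atTop (𝓝 0) ∧
      ∃ sch : SpeciesScheme ι, (∀ k, sch.a k = a (sch.β k)) ∧ ¬ sch.HasWeakCouplingLimit := by
  refine ⟨fun β => (1 + β ^ 2)⁻¹, Continuous.inv₀ (by fun_prop) fun β => by positivity,
    fun β => by positivity, ?_, ?_⟩
  · refine tendsto_inv_atTop_zero.comp (tendsto_atTop_add_const_left _ _ ?_)
    exact tendsto_pow_atTop two_ne_zero
  let sch : SpeciesScheme ι :=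
    { a := fun k => (1 + ((k : ℝ) + 1) ^ 2)⁻¹
      a_pos := fun k => by positivity
      tendsto_a := by
        refine tendsto_inv_atTop_zero.comp (tendsto_atTop_add_const_left _ _ ?_)
        exact (tendsto_pow_atTop two_ne_zero).comp
          (tendsto_natCast_atTop_atTop.atTop_add tendsto_const_nhds)
      β := fun k => -((k : ℝ) + 1)
      L := fun k => (k + 1) ^ 3
      tendsto_L := by
        have hle : ∀ k : ℕ, ((k : ℝ) + 1) / 2 ≤
            (1 + ((k : ℝ) + 1) ^ 2)⁻¹ * (((k + 1) ^ 3 : ℕ) : ℝ) := by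
          intro k
          have hpos : (0 : ℝ) < 1 + ((k : ℝ) + 1) ^ 2 := by positivity
          have h3 : 0 ≤ ((k : ℝ) + 1) * (((k : ℝ) + 1) ^ 2 - 1) :=
            mul_nonneg (by positivity) (by nlinarith [(Nat.cast_nonneg k : (0 : ℝ) ≤ k)])
          have key : ((k : ℝ) + 1) / 2 * (1 + ((k : ℝ) + 1) ^ 2) ≤ (((k + 1) ^ 3 : ℕ) : ℝ) := by
            push_cast
            nlinarith [h3]
          calc ((k : ℝ) + 1) / 2
              = ((k : ℝ) + 1) / 2 * (1 + ((k : ℝ) + 1) ^ 2) * (1 + ((k : ℝ) + 1) ^ 2)⁻¹ := by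
                field_simp
            _ ≤ (((k + 1) ^ 3 : ℕ) : ℝ) * (1 + ((k : ℝ) + 1) ^ 2)⁻¹ :=
                mul_le_mul_of_nonneg_right key (inv_nonneg.2 hpos.le)
            _ = _ := mul_comm _ _
        refine tendsto_atTop_mono hle ?_
        exact (tendsto_natCast_atTop_atTop.atTop_add tendsto_const_nhds).atTop_div_const
          (by norm_num : (0 : ℝ) < 2)
      c := fun _ _ => 0
      m := fun _ _ => 0 }
  refine ⟨sch, fun k => ?_, ?_⟩
  · show (1 + ((k : ℝ) + 1) ^ 2)⁻¹ = (1 + (-((k : ℝ) + 1)) ^ 2)⁻¹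
    rw [neg_sq]
  · exact SpeciesScheme.not_hasWeakCouplingLimit_of_le _ (B := 0) fun k => by
      show -((k : ℝ) + 1) ≤ 0
      linarith [(Nat.cast_nonneg k : (0 : ℝ) ≤ k)]

end Conjunct

end Summit.QuantumFields.YangMills.Theorems.OSLegsAtWeakCouplingC.Negative

end
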